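import Summits.AnomalousDissipation.AnomalousDissipation.Theorems.SolenoidalFractalHomogenisationLagrangianStepSidebandOwnSlotFeedback
import Summits.AnomalousDissipation.AnomalousDissipation.Theorems.SolenoidalFractalHomogenisationLagrangianStepSidebandLinear
import HarnessLib

/-!
# K1L_D `stub_D1_exactFamily` clause (i) (`stub_D1_residueTail`, registry v17) — brick A1(c)-III(b1): THE PERIOD MEAN `M_{jj'}` IS A SLOT-`j` INTEGRAL
# (the feedback of slot `j` vanishes off its slot) (helper; `--supports stmt-AnomalousDissipation-27980`)

Summits-side helper file of route `SolenoidalFractalHomogenisation` (prover seat `ad-sawtooth-k1loc-p1` g12; variant A of D26-6/D26-7; identification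
`diag psiStar = excQS` (`κ = 1`, `WCrossing.ΨB₁` p687442, j322426) and the structure theorem `psiStar − excQS − pairQS = tails` behind the v17 stub
`stub_D1_residueTail`).  Everything proved; no definitions, no named facts, no sorry.
* `slotEnvelope_eq_zero_of_le_start` / `_of_end_le` — within the first period `[0, P]` the envelope of slot `j` vanishes before `startⱼ` and after
  `startⱼ + τⱼ`;
* `continuousOn_feedback_comp_response`, `intervalIntegrable_feedback_comp_response` — the integrand of `Sideband.meanFeedback` is continuous on `[0, P]`;
* **`meanFeedback_eq_slot_integral`** — `M_{jj'} = (1/P) • ∫_{startⱼ}^{startⱼ+τⱼ} feedbackⱼ(t)↾ℝ ∘ response_{j'}(t) dt` whenever slot `j'` has a periodic response: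
  together with `…SidebandOwnSlotFeedback.feedback_response_eq_of_mem_slot` (diagonal) this reduces every entry of `psiStar` to own-slot Duhamel data.
NOT a proof of any registered stub, of the crux, or of anomalous dissipation; rung leaf F-D1 infrastructure.
-/

set_option linter.dupNamespace false

noncomputable section

namespace Summit.AnomalousDissipation.AnomalousDissipation.Theorems.SolenoidalFractalHomogenisation.LagrangianStep.Sideband

open Set MeasureTheory Complex NormedSpace intervalIntegral
open scoped InnerProductSpace
open Literature.Analysis Literature.Analysis.FunctionSpaces Literature.Analysis.FunctionSpaces.Torus
open Literature.Analysis.FluidPDE Literature.Analysis.FluidPDE.Torus Literature.Analysis.FluidPDE.LatticeShear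
open Summit.AnomalousDissipation.AnomalousDissipation.Theorems.SolenoidalFractalHomogenisation.PermissibleCarrier
  (start_nonneg start_add_tau_le_period period_pos trapezoid_eq_zero_of_le trapezoid_eq_zero_of_ge)
open Summit.AnomalousDissipation.AnomalousDissipation.Theorems.SolenoidalFractalHomogenisation.RealisedQuasiStaticCellLaw (fract_period_mul)

variable {k₀ : ℕ}

/-! ## §1 The envelope of slot `j` vanishes off its slot (first period) -/

/-- On `[0, P)` the reduced time is the time itself. [folklore] -/
theorem fract_div_period_mul_eq_self (W₁ : LatticeWord k₀) {t : ℝ} (h0 : 0 ≤ t) (hP : t < W₁.period) :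
    Int.fract (t / W₁.period) * W₁.period = t := by
  have h := fract_period_mul (period_pos W₁) 0 h0 hP
  simpa using h

/-- Before its start, within the first period, the envelope of slot `j` vanishes. [folklore] -/
theorem slotEnvelope_eq_zero_of_le_start (W₁ : LatticeWord k₀) (j : Fin k₀) {t : ℝ} (h0 : 0 ≤ t) (ht : t ≤ W₁.start j) :
    slotEnvelope W₁ j t = 0 := by
  have hρτ : 0 < W₁.ramp * (W₁.phase j).τ := mul_pos W₁.ramp_pos (W₁.phase j).τ_pos
  have hP : t < W₁.period := lt_of_le_of_lt ht (by linarith [start_add_tau_le_period W₁ j, (W₁.phase j).τ_pos])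
  rw [slotEnvelope_def, fract_div_period_mul_eq_self W₁ h0 hP]
  exact trapezoid_eq_zero_of_le hρτ ht

/-- After its end, within the first period `[0, P]`, the envelope of slot `j` vanishes. [folklore] -/
theorem slotEnvelope_eq_zero_of_end_le (W₁ : LatticeWord k₀) (j : Fin k₀) {t : ℝ} (ht : W₁.start j + (W₁.phase j).τ ≤ t) (hP : t ≤ W₁.period) :
    slotEnvelope W₁ j t = 0 := by
  have hρτ : 0 < W₁.ramp * (W₁.phase j).τ := mul_pos W₁.ramp_pos (W₁.phase j).τ_pos
  have h0 : 0 ≤ t := le_trans (by linarith [start_nonneg W₁ j, (W₁.phase j).τ_pos]) ht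
  rcases lt_or_eq_of_le hP with hlt | heq
  · rw [slotEnvelope_def, fract_div_period_mul_eq_self W₁ h0 hlt]
    exact trapezoid_eq_zero_of_ge hρτ ht
  · rw [slotEnvelope_def, heq, div_self (period_pos W₁).ne', Int.fract_one, zero_mul]
    exact trapezoid_eq_zero_of_le hρτ (start_nonneg W₁ j)

/-! ## §2 The integrand of the period mean -/

/-- The integrand `t ↦ feedbackⱼ(t)↾ℝ ∘ N t` is continuous on `[0, P]` for a periodic response `N`. [cite: MajdaKramer1999, §2.2.1.3 (55)] -/
theorem continuousOn_feedback_comp (W₁ : LatticeWord k₀) (𝔸 : Torus.Visc4 (Fin 3)) (γ₁ : ℝ) (R : ℕ) (j j' : Fin k₀)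
    {N : ℝ → (EuclideanSpace ℂ (Fin 3) →L[ℝ] Space R)} (hN : IsPeriodicResponse W₁ 𝔸 γ₁ R j' N) :
    ContinuousOn (fun t => ((feedback W₁ R j t).restrictScalars ℝ).comp (N t)) (Icc 0 W₁.period) := by
  have hf : Continuous fun t => (feedback W₁ R j t).restrictScalars ℝ :=
    (ContinuousLinearMap.restrictScalarsIsometry ℂ (Space R) (EuclideanSpace ℂ (Fin 3)) ℝ ℝ).continuous.comp (continuous_feedback W₁ R j)
  exact hf.continuousOn.clm_comp hN.1

/-- Hence interval-integrable on every sub-interval of `[0, P]`. [cite: MajdaKramer1999, §2.2.1.3 (55)] -/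
theorem intervalIntegrable_feedback_comp (W₁ : LatticeWord k₀) (𝔸 : Torus.Visc4 (Fin 3)) (γ₁ : ℝ) (R : ℕ) (j j' : Fin k₀)
    {N : ℝ → (EuclideanSpace ℂ (Fin 3) →L[ℝ] Space R)} (hN : IsPeriodicResponse W₁ 𝔸 γ₁ R j' N) {a b : ℝ}
    (ha : 0 ≤ a) (hab : a ≤ b) (hb : b ≤ W₁.period) :
    IntervalIntegrable (fun t => ((feedback W₁ R j t).restrictScalars ℝ).comp (N t)) volume a b :=
  ((continuousOn_feedback_comp W₁ 𝔸 γ₁ R j j' hN).mono (Icc_subset_Icc ha hb)).intervalIntegrable_of_Icc hab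

/-- Off slot `j` (first period) the integrand vanishes. [cite: MajdaKramer1999, §2.2.1.3 (55)] -/
theorem feedback_comp_eq_zero_of_not_mem_slot (W₁ : LatticeWord k₀) (R : ℕ) (j : Fin k₀)
    (N : ℝ → (EuclideanSpace ℂ (Fin 3) →L[ℝ] Space R)) {t : ℝ} (h0 : 0 ≤ t) (hP : t ≤ W₁.period)
    (ht : t ≤ W₁.start j ∨ W₁.start j + (W₁.phase j).τ ≤ t) :
    ((feedback W₁ R j t).restrictScalars ℝ).comp (N t) = 0 := by
  have henv : slotEnvelope W₁ j t = 0 := by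
    rcases ht with h | h
    · exact slotEnvelope_eq_zero_of_le_start W₁ j h0 h
    · exact slotEnvelope_eq_zero_of_end_le W₁ j h hP
  rw [feedback_eq_zero_of_slotEnvelope W₁ R j henv]
  simp

/-! ## §3 The period mean is a slot integral -/

/-- **`M_{jj'}` IS A SLOT-`j` INTEGRAL.**  If slot `j'` has a periodic response, then
`meanFeedback W₁ 𝔸 γ₁ R j j' = (1/P) • ∫_{startⱼ}^{startⱼ + τⱼ} feedbackⱼ(t)↾ℝ ∘ response_{j'}(t) dt`. [cite: MajdaKramer1999, §2.2.1.3 (55)] -/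
theorem meanFeedback_eq_slot_integral (W₁ : LatticeWord k₀) (𝔸 : Torus.Visc4 (Fin 3)) (γ₁ : ℝ) (R : ℕ) (j j' : Fin k₀)
    (h : ∃ N, IsPeriodicResponse W₁ 𝔸 γ₁ R j' N) :
    meanFeedback W₁ 𝔸 γ₁ R j j' = (1 / W₁.period) •
      ∫ t in W₁.start j..W₁.start j + (W₁.phase j).τ, ((feedback W₁ R j t).restrictScalars ℝ).comp (response W₁ 𝔸 γ₁ R j' t) := by
  have hN := isPeriodicResponse_response h
  set t₀ := W₁.start j with ht₀
  set t₁ := W₁.start j + (W₁.phase j).τ with ht₁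
  have h0 : 0 ≤ t₀ := start_nonneg W₁ j
  have h01 : t₀ ≤ t₁ := by rw [ht₁]; linarith [(W₁.phase j).τ_pos]
  have h1P : t₁ ≤ W₁.period := start_add_tau_le_period W₁ j
  set F : ℝ → (EuclideanSpace ℂ (Fin 3) →L[ℝ] EuclideanSpace ℂ (Fin 3)) :=
    fun t => ((feedback W₁ R j t).restrictScalars ℝ).comp (response W₁ 𝔸 γ₁ R j' t) with hF
  have hI1 : IntervalIntegrable F volume 0 t₀ := intervalIntegrable_feedback_comp W₁ 𝔸 γ₁ R j j' hN le_rfl h0 (h01.trans h1P)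
  have hI2 : IntervalIntegrable F volume t₀ t₁ := intervalIntegrable_feedback_comp W₁ 𝔸 γ₁ R j j' hN h0 h01 h1P
  have hI3 : IntervalIntegrable F volume t₁ W₁.period := intervalIntegrable_feedback_comp W₁ 𝔸 γ₁ R j j' hN (h0.trans h01) h1P le_rfl
  have hz1 : ∫ t in (0:ℝ)..t₀, F t = 0 := by
    have hE : EqOn F (fun _ => (0 : EuclideanSpace ℂ (Fin 3) →L[ℝ] EuclideanSpace ℂ (Fin 3))) (uIcc 0 t₀) := by
      intro t ht
      rw [uIcc_of_le h0] at ht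
      exact feedback_comp_eq_zero_of_not_mem_slot W₁ R j _ ht.1 (ht.2.trans (h01.trans h1P)) (Or.inl ht.2)
    rw [intervalIntegral.integral_congr hE, intervalIntegral.integral_zero]
  have hz3 : ∫ t in t₁..W₁.period, F t = 0 := by
    have hE : EqOn F (fun _ => (0 : EuclideanSpace ℂ (Fin 3) →L[ℝ] EuclideanSpace ℂ (Fin 3))) (uIcc t₁ W₁.period) := by
      intro t ht
      rw [uIcc_of_le h1P] at ht
      exact feedback_comp_eq_zero_of_not_mem_slot W₁ R j _ ((h0.trans h01).trans ht.1) ht.2 (Or.inr ht.1)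
    rw [intervalIntegral.integral_congr hE, intervalIntegral.integral_zero]
  have hsplit : ∫ t in (0:ℝ)..W₁.period, F t = ∫ t in t₀..t₁, F t := by
    rw [← intervalIntegral.integral_add_adjacent_intervals hI1 (hI2.trans hI3),
      ← intervalIntegral.integral_add_adjacent_intervals hI2 hI3, hz1, hz3, zero_add, add_zero]
  rw [meanFeedback, hsplit]

end Summit.AnomalousDissipation.AnomalousDissipation.Theorems.SolenoidalFractalHomogenisation.LagrangianStep.Sideband
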